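import Summits.AnomalousDissipation.AnomalousDissipation.Theorems.BaireTransferDenseLoudDesignerForcesErgodicGlue
import Summits.AnomalousDissipation.AnomalousDissipation.Theorems.BaireTransferDenseLoudDesignerForcesStubBirkhoffMeans
import Summits.AnomalousDissipation.AnomalousDissipation.Theorems.BaireTransferDenseLoudDesignerForcesStubTrajectoryPowerBudget
import Summits.AnomalousDissipation.AnomalousDissipation.Theorems.BaireTransferDenseLoudDesignerForcesStubRecurrence
import Summits.AnomalousDissipation.AnomalousDissipation.Theorems.BaireTransferDenseLoudDesignerForcesStubShadowBudgets
import Summits.AnomalousDissipation.AnomalousDissipation.Theorems.BaireTransferDenseLoudDesignerForcesStubClassicalPeriodicWitness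
import Summits.AnomalousDissipation.AnomalousDissipation.Theorems.BaireTransferDenseLoudDesignerForcesErgodicClosing
import Summits.AnomalousDissipation.AnomalousDissipation.Theorems.BaireTransferDenseLoudDesignerForcesStubLoudInvariantMeasureOrbitClosure
import Summits.AnomalousDissipation.AnomalousDissipation.Theorems.BaireTransferDenseLoudDesignerForcesErgodicEncodingEquiv
import Summits.AnomalousDissipation.AnomalousDissipation.Theorems.BaireTransferDenseLoudDesignerForcesErgodicEntrySteadyState
import Summits.AnomalousDissipation.AnomalousDissipation.Theorems.BaireTransferDenseLoudDesignerForcesErgodicPeriodicOrbitB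
import Summits.AnomalousDissipation.AnomalousDissipation.Theorems.BaireTransferDenseLoudDesignerForcesErgodicModel
import Literature.Dynamics.Hyperbolic.HyperbolicSemiflowModel
import HarnessLib.Audit

/-!
# Line `ergodic-budget-selection-closing` — the v10 CONDITIONAL COMPOSITION of the crux `BaireTransfer.DenseLoudDesignerForces`
(item stmt-AnomalousDissipation-1143; tools-stub `ergodic_line_glue_v10`, lead c5-0, 2026-08-16)

The skeleton v10 of the line (`Cruxes/DenseLoudDesignerForces/Lines/ergodic_budget_selection_closing.lean`) reduces the crux
`DenseLoudDesignerForces` (dense loud periodic classical NS_ν orbits for fixed-degree steady designer forces) to exactly THREE open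
registered stubs:

  * **1′** `stub_denseLoudHyperbolicTrajectories` (physics residual): dense forces carrying an NS phase with ONE loud trajectory all of
    whose loud orbit-closure invariant measures are hyperbolic;
  * **N** `stub_smoothModel` (Navier–Stokes analysis): every hyperbolic invariant measure of an NS phase has a smooth `C²` local
    semiflow model `IsHyperbolicSemiflowModel U Λ g m` conjugated into an enlarged NS phase (`IsSmoothModelOf`);
  * **D** `stub_ambientClosing` (smooth ergodic theory in Hilbert space): `IsHyperbolicSemiflowModel U Λ g m → HasAmbientClosing U Λ g m`
    (Katok 1980 Main Lemma; Lian–Young 2012 for semiflows on Hilbert spaces).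

Everything else is LANDED: the seven-stub glue `ergodic_line_glue` (budget selection, p85006), Stubs 3a/3b/4a/4b/5
(`stub_birkhoffMeans`, `stub_trajectoryPowerBudget`, `stub_recurrence`, `stub_shadowBudgets`, `stub_classicalPeriodicWitness`),
Krylov–Bogolyubov on the orbit closure (`stub_loudInvariantMeasure_orbitClosure`, `IsNSPhase.orbitClosure`) and the transport G
(`hasKatokClosing_of_smoothModel`).  This file records the conditional theorem **1′ ∧ N ∧ D ⇒ crux** permanently and sorry-free: the three
open stubs enter ONLY as hypotheses `h1`, `hN`, `hD`; nothing is asserted.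

References: Z. Lian, L.-S. Young, JAMS 25 (2012) §1; A. Katok, Publ. IHÉS 51 (1980) §3; Foias–Manley–Rosa–Temam,
*Navier–Stokes Equations and Turbulence* (CUP 2001) Ch. IV.
-/

set_option linter.dupNamespace false

noncomputable section

open scoped BigOperators Topology ENNReal InnerProductSpace
open Filter Set Function MeasureTheory

namespace Summit.AnomalousDissipation.AnomalousDissipation.Theorems.DenseLoudDesignerForces.Ergodic

open Literature.Analysis.FunctionSpaces Literature.Analysis.FunctionSpaces.Torus
open Literature.Analysis.FluidPDE Literature.Analysis.FluidPDE.Torus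
open Summit.AnomalousDissipation.AnomalousDissipation.Theses.BaireTransfer
open Summit.AnomalousDissipation.AnomalousDissipation.Theorems.DenseLoudDesignerForces.Negative
open Literature.Dynamics.Hyperbolic

section GlueV10

/-! ## §1 Glue: Stub 1 from Stub 1′ (hypothesis) and Stub KB′; Stub 2 from N, D (hypotheses) and G -/

/-- **Pointwise glue**: a force whose NS phase carries one loud trajectory whose orbit closure carries only hyperbolic LOUD
invariant measures lies in `hypLoudSet` — the loud hyperbolic invariant measure lives on the orbit closure (an NS phase,
`IsNSPhase.orbitClosure`) by Krylov–Bogolyubov with budgets there (`stub_loudInvariantMeasure_orbitClosure`). [folklore] -/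
theorem mem_hypLoudSet_of_loudTrajectory {S : Finset (Fin 3 → ℤ)} {E ε : ℝ} {j : ℕ}
    {c : ↥S → (EuclideanSpace ℂ (Fin 3))}
    (hc : ∃ ν : ℝ, 0 < ν ∧ ν < 1 / ((j : ℝ) + 1) ∧
      ∃ (K : Set Hsp) (φ : ℝ → Hsp → Hsp), IsNSPhase ν (force S c) K φ ∧
        ∃ x ∈ K, (∀ᶠ T in atTop, energyAvg φ x T ≤ E) ∧ (∃ᶠ T in atTop, ε ≤ dissipAvg ν φ x T) ∧
          ∀ μ : Measure Hsp, IsInvariantMeasure (closure ((fun t : ℝ => φ t x) '' Ici 0)) φ μ →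
            ensembleEnergy μ ≤ E → ε ≤ ensembleDissipation ν μ → IsHyperbolicMeasure ν (force S c) φ μ) :
    c ∈ hypLoudSet S E ε j := by
  obtain ⟨ν, hν, hνj, K, φ, hK, x, hx, hE, hε, hH⟩ := hc
  obtain ⟨μ, hμ, hEμ, hεμ⟩ := stub_loudInvariantMeasure_orbitClosure hK hx hE hε
  exact ⟨ν, hν, hνj, _, φ, μ, hK.orbitClosure hx, hμ, hEμ, hεμ, hH μ hμ hEμ hεμ⟩

/-- **Stub 1 (planner's form) from Stub 1′**: dense loud hyperbolic trajectories (hypothesis `h1`, the registered physics residual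
`stub_denseLoudHyperbolicTrajectories`) give dense loud hyperbolic invariant measures (`closure_mono` over the pointwise glue). [folklore] -/
theorem denseHyperbolicLoudMeasures_of
    (h1 : ∀ S₀ : Finset (Fin 3 → ℤ), ∃ S : Finset (Fin 3 → ℤ), S₀ ⊆ S ∧ ∃ (E ε : ℝ), 0 < ε ∧
      ∃ U : Set (↥S → (EuclideanSpace ℂ (Fin 3))), IsOpen U ∧ U.Nonempty ∧ ∀ j : ℕ,
        U ⊆ closure {c : ↥S → (EuclideanSpace ℂ (Fin 3)) | ∃ ν : ℝ, 0 < ν ∧ ν < 1 / ((j : ℝ) + 1) ∧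
          ∃ (K : Set Hsp) (φ : ℝ → Hsp → Hsp), IsNSPhase ν (force S c) K φ ∧
            ∃ x ∈ K, (∀ᶠ T in atTop, energyAvg φ x T ≤ E) ∧ (∃ᶠ T in atTop, ε ≤ dissipAvg ν φ x T) ∧
              ∀ μ : Measure Hsp, IsInvariantMeasure (closure ((fun t : ℝ => φ t x) '' Ici 0)) φ μ →
                ensembleEnergy μ ≤ E → ε ≤ ensembleDissipation ν μ → IsHyperbolicMeasure ν (force S c) φ μ}) :
    ∀ S₀ : Finset (Fin 3 → ℤ), ∃ S : Finset (Fin 3 → ℤ), S₀ ⊆ S ∧ ∃ (E ε : ℝ), 0 < ε ∧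
      ∃ U : Set (↥S → (EuclideanSpace ℂ (Fin 3))), IsOpen U ∧ U.Nonempty ∧ ∀ j : ℕ, U ⊆ closure (hypLoudSet S E ε j) := by
  intro S₀
  obtain ⟨S, hS, E, ε, hε, U, hU, hUne, hdense⟩ := h1 S₀
  refine ⟨S, hS, E, ε, hε, U, hU, hUne, fun j => (hdense j).trans (closure_mono fun c hc => ?_)⟩
  exact mem_hypLoudSet_of_loudTrajectory hc

/-- **Stub 2 — the closing lemma for the NS_ν semiflow, ENLARGING THE PHASE — from N, D (hypotheses `hN`, `hD`, the registered stubs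
`stub_smoothModel`, `stub_ambientClosing`) and the landed transport G `hasKatokClosing_of_smoothModel`**: the smooth model of N, the
ambient closing of D on it, transported by G to `HasKatokClosing` in the enlarged phase.
[cite: LianYoung2012, §1 and the closing lemma for hyperbolic measures of semiflows] -/
theorem closingLemma_of_model
    (hN : ∀ {S : Finset (Fin 3 → ℤ)} {c : ↥S → (EuclideanSpace ℂ (Fin 3))} {ν : ℝ} {K : Set Hsp} {φ : ℝ → Hsp → Hsp}
      {μ : Measure Hsp}, 0 < ν → IsNSPhase ν (force S c) K φ → IsInvariantMeasure K φ μ → IsHyperbolicMeasure ν (force S c) φ μ →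
      ∃ (K' : Set Hsp) (φ' : ℝ → Hsp → Hsp) (Smap : Hsp →L[ℝ] Hsp) (U Λ : Set Hsp) (g : ℝ → Hsp → Hsp) (m : Measure Hsp),
        K ⊆ K' ∧ (∀ t : ℝ, 0 ≤ t → ∀ x ∈ K, φ' t x = φ t x) ∧ IsNSPhase ν (force S c) K' φ' ∧
          IsHyperbolicSemiflowModel U Λ g m ∧ IsSmoothModelOf K' φ' μ Smap U Λ g m)
    (hD : ∀ {U Λ : Set Hsp} {g : ℝ → Hsp → Hsp} {m : Measure Hsp}, IsHyperbolicSemiflowModel U Λ g m → HasAmbientClosing U Λ g m)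
    {S : Finset (Fin 3 → ℤ)} {c : ↥S → (EuclideanSpace ℂ (Fin 3))} {ν : ℝ} {K : Set Hsp} {φ : ℝ → Hsp → Hsp}
    {μ : Measure Hsp} (hν : 0 < ν) (hK : IsNSPhase ν (force S c) K φ) (hμ : IsInvariantMeasure K φ μ)
    (hH : IsHyperbolicMeasure ν (force S c) φ μ) :
    ∃ (K' : Set Hsp) (φ' : ℝ → Hsp → Hsp), K ⊆ K' ∧ (∀ t : ℝ, 0 ≤ t → ∀ x ∈ K, φ' t x = φ t x) ∧
      IsNSPhase ν (force S c) K' φ' ∧ HasKatokClosing K' φ' μ := by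
  obtain ⟨K', φ', Smap, U, Λ, g, m, hsub, hagree, hK', hmodel, hS⟩ := hN hν hK hμ hH
  exact ⟨K', φ', hsub, hagree, hK', hasKatokClosing_of_smoothModel hS (hD hmodel)⟩

/-! ## §2 The registered tools-stub: the conditional composition 1′ → N → D → crux -/

/-- **Tools-stub `ergodic_line_glue_v10` — the v10 conditional composition of the line `ergodic-budget-selection-closing`.**
Stub 1′ (physics residual: dense forces with an NS phase carrying a loud trajectory whose loud orbit-closure invariant measures are
hyperbolic), Stub N (smooth hyperbolic `C²` local semiflow model of an enlarged NS phase) and Stub D (ambient Katok / Lian–Young closing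
for such models) imply the crux `DenseLoudDesignerForces` BY NAME: the landed seven-stub glue `ergodic_line_glue` fed with Stub 1
(`denseHyperbolicLoudMeasures_of h1`), Stub 2 (`closingLemma_of_model hN hD`) and the landed Stubs 3a, 3b, 4a, 4b, 5.
[cite: LianYoung2012, §1 (hyperbolic measures of dissipative parabolic semiflows; closing lemma)] -/
theorem ergodic_line_glue_v10 :
    (∀ S₀ : Finset (Fin 3 → ℤ), ∃ S : Finset (Fin 3 → ℤ), S₀ ⊆ S ∧ ∃ (E ε : ℝ), 0 < ε ∧
      ∃ U : Set (↥S → (EuclideanSpace ℂ (Fin 3))), IsOpen U ∧ U.Nonempty ∧ ∀ j : ℕ,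
        U ⊆ closure {c : ↥S → (EuclideanSpace ℂ (Fin 3)) | ∃ ν : ℝ, 0 < ν ∧ ν < 1 / ((j : ℝ) + 1) ∧
          ∃ (K : Set Hsp) (φ : ℝ → Hsp → Hsp), IsNSPhase ν (force S c) K φ ∧
            ∃ x ∈ K, (∀ᶠ T in atTop, energyAvg φ x T ≤ E) ∧ (∃ᶠ T in atTop, ε ≤ dissipAvg ν φ x T) ∧
              ∀ μ : Measure Hsp, IsInvariantMeasure (closure ((fun t : ℝ => φ t x) '' Ici 0)) φ μ →
                ensembleEnergy μ ≤ E → ε ≤ ensembleDissipation ν μ → IsHyperbolicMeasure ν (force S c) φ μ}) →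
    (∀ {S : Finset (Fin 3 → ℤ)} {c : ↥S → (EuclideanSpace ℂ (Fin 3))} {ν : ℝ} {K : Set Hsp} {φ : ℝ → Hsp → Hsp}
      {μ : Measure Hsp}, 0 < ν → IsNSPhase ν (force S c) K φ → IsInvariantMeasure K φ μ →
      IsHyperbolicMeasure ν (force S c) φ μ →
      ∃ (K' : Set Hsp) (φ' : ℝ → Hsp → Hsp) (Smap : Hsp →L[ℝ] Hsp) (U Λ : Set Hsp) (g : ℝ → Hsp → Hsp) (m : Measure Hsp),
        K ⊆ K' ∧ (∀ t : ℝ, 0 ≤ t → ∀ x ∈ K, φ' t x = φ t x) ∧ IsNSPhase ν (force S c) K' φ' ∧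
          IsHyperbolicSemiflowModel U Λ g m ∧ IsSmoothModelOf K' φ' μ Smap U Λ g m) →
    (∀ {U Λ : Set Hsp} {g : ℝ → Hsp → Hsp} {m : Measure Hsp}, IsHyperbolicSemiflowModel U Λ g m → HasAmbientClosing U Λ g m) →
    DenseLoudDesignerForces :=
  fun h1 hN hD => ergodic_line_glue (denseHyperbolicLoudMeasures_of h1) (closingLemma_of_model hN hD) @stub_birkhoffMeans
    @stub_trajectoryPowerBudget @stub_recurrence @stub_shadowBudgets @stub_classicalPeriodicWitness

end GlueV10

end Summit.AnomalousDissipation.AnomalousDissipation.Theorems.DenseLoudDesignerForces.Ergodic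

end
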